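/-
Copyright (c) 2026 the pub-hodgecm-mathlib formalisation cell (harness21).  Prover seat hodgecm-mathlib-LH5-p02 (g4): line LH3 (closer stub `stub_N9`), LETTER L1 clauses (I₂)∕(I₁),
LH3-plan (g3) RULING #17 brick (B-desc′) «NON-GENERIC FACE POINTS» — its (A4)-ENGINE HALF (the parametric, abstract-integrand smooth model).
-/
import Literature.NumberTheory.Rogawski1990.ArchOrbFamGSmoothModel   -- ★ (A4) p850939∕p851054 (this seat): §1–§4 (`chartTorusGLoc_eq_centralizer_gprimeBlock`, `uniformlyProper_gprimeBlock_pi_inRegG`, `forall_mem_pi_chartTorusGLoc_comm`, `contDiff_coe_gprimeBlock`, head `contDiffOn_smoothModel_inRegG`); brings ★ (A4-gen) `…_fibre_of_uniformlyProper_local`, ★ `isOpen_inRegG`, ★ `dense_regG`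
import HarnessLib

/-!
# (A4′) THE PARAMETRIC, ABSTRACT-INTEGRAND SMOOTH MODEL: `C^∞` on `{c | in-regular at the places e i} × T`
# (engine half of (B-desc′) «box descent at non-generic face points»; Varadarajan 1977 I §1.12, Rogawski 1990 §8.2–8.3, Hörmander Thm. 1.1.9)

Topic `NumberTheory/Rogawski1990`; namespace `Literature.NumberTheory.Automorphic.UnitaryGroup`.  THEOREMS ONLY (no `def`, no instance, no notation, no axiom, no named fact,
no `sorry`); kernel lane `--kind proof --supports stmt-HodgeConjecture-24833`.  Cell `pub/hodgecm-mathlib`, crux H413 (`stmt-HodgeConjecture-24833`), F0∕P3c line LH3 (closer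
stub `stub_N9`), LETTER L1 `HcOrbitalFamiliesStatement`: LH3-plan (g3) RULING #17 (2026-09-02T10:30:53Z) booked the (I₁) brick **(B-desc′) «NON-GENERIC FACE POINTS»** (box
descent on `U ∩ InRegG` around a point with ONE noncompact coincidence at a compact place `w₀`, the OTHER compact places only in-regular, the split coordinates arbitrary, the
`w₀`-block variable carried as an extra smooth parameter of the (A4) engine; PROOF LH7-p02 (g4), SIGNATURE LH7-p04 (g4)).  THIS FILE is its (A4)-ENGINE HALF, offered by the (A4)
holder (LH5-p02 (g4), 2026-09-02T10:4xZ): the sequel of ★ (A4) `ArchOrbFamGSmoothModel` in which (a) the test-function integrand is ABSTRACT — any fibred `F q g η` factoring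
smoothly through the matrix reading `(↑↑g_i)_i` of the compact places, a continuous fibre datum `r η` and the parameter `q = (c, z)` — so that the consumer's recombination `ρ_z`,
ambient reading, movers and cut-offs all live inside ONE smooth `Θ`; (b) an extra finite-dimensional parameter `z ∈ T` (open) rides along; (c) the coordinate domain is the LARGER
open set `{c | in-regular at every e i}` (no condition at places outside `range e` — (B-desc′)'s base point sits ON the `w₀`-wall); (d) the support hypothesis is the weakest one,
per compact `K ⊆ {…} × T` (ONE compact of `G_c` and ONE compact of the fibre).
* §1 `exists_adInvariant_datum` — the commutant-projection trick of ★ `contDiffOn_chartOrbG_of_uniformlyProper` as a LEMMA (generic: a topological group read multiplicatively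
  and continuously in a finite-dimensional real normed algebra): `E(y γ y⁻¹) = Σ_k ℓ_k(E γ) • p(y)_k` with `p` continuous and `M`-right-invariant, `ℓ_k` continuous linear.
* §2 `isOpen_setOf_inRegAt`, `uniformlyProper_gprimeBlock_pi_inRegAt` — openness of `{c | in-regular at every e i}` (a preimage of ★ `InRegG`) and (HYP) on it (same proof as
  ★ (A4) §2, which is its restriction to `InRegG (slotSign α) S′`).
* §3 HEAD **`contDiffOn_smoothModel_prod_param`** — `q ↦ pref q · ∫_{(G_c ⧸ M_c) × Y} F q (y · γ_c(q.1) · y⁻¹) η d(μ ⊗ ν)` is `ContDiffOn ℝ ∞` on `{c | in-regular at every e i} ×ˢ T`: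
  localised ★ (A4-gen) `contDiffOn_integral_prod_descConj_fibre_of_uniformlyProper_local` on a relatively compact open box around each point (§2 (HYP), ★ (A4) §3 `hcomm`, §1 datum).
  The (A4) head `contDiffOn_smoothModel_inRegG` is the case `F = a′ ∘ ρ`, `Y = Π_j (K_j × N)`, no parameter.
HONEST LABEL: HC_CM is proved only modulo the 7 printed citations (2 remaining named inputs: hLiu418 = `stmt-HodgeConjecture-24832`, h413 = `stmt-HodgeConjecture-24833`) until
rung 0 closes; count-neutral letter-L1 plumbing (pays nothing by itself; (B-desc′) assembles).

## References
* [Varadarajan1977] V. S. Varadarajan, *Harmonic Analysis on Real Reductive Groups*, LNM 576 (1977), Part I §1.12 (parabolic descent of `'F_f`).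
* [Rogawski1990] J. D. Rogawski, *Automorphic Representations of Unitary Groups in Three Variables*, Ann. of Math. Stud. 123 (1990), §4.3 p. 43, §4.12 Lemma 4.12.1 p. 61, §8.2–§8.3 pp. 118–124.
* [Bouaziz1994IntegralesOrbitales] A. Bouaziz, *Intégrales orbitales sur les groupes de Lie réductifs*, Ann. Sci. ÉNS 27 (1994), §6.2 p. 591 (`T_{in-reg}`).
* [HormanderALPDO1] L. Hörmander, *The Analysis of Linear Partial Differential Operators I*, 2nd ed. (1990), §1.1 Thm. 1.1.9.
* [HarishChandra1970] Harish-Chandra (notes by G. van Dijk), *Harmonic Analysis on Reductive p-adic Groups*, LNM 162 (1970), Part V §4 Lemma 22 (compactness lemma).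
-/

set_option autoImplicit false

noncomputable section

open MeasureTheory MeasureTheory.Measure Matrix NumberField NumberField.InfinitePlace NumberField.mixedEmbedding Set Function Topology Complex
open Literature.MeasureTheory.Group Literature.NumberTheory.Rogawski1990 Literature.NumberTheory.Automorphic.ArchCartan
open Literature.NumberTheory.Automorphic.UnitaryGroup
open scoped MatrixGroups ContDiff Classical
open scoped Matrix.Norms.Operator

/-! ## §1 The `M`-invariant datum of the adjoint orbit map; §2 `{c | in-regular at every e i}` and (HYP) on it; §3 the head -/

namespace Literature.NumberTheory.Automorphic.UnitaryGroup

section AdDatum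

/-- **THE `M`-INVARIANT DATUM OF THE ADJOINT ORBIT MAP** (the commutant-projection trick of ★ `contDiffOn_chartOrbG_of_uniformlyProper`, as a lemma).  `G` a topological group read
in a finite-dimensional real normed algebra `𝔸` by a continuous multiplicative `E` (`E 1 = 1`), `M ≤ G`: there are finitely many continuous linear forms `ℓ_k` on `𝔸` and a
continuous `M`-RIGHT-INVARIANT datum `p : G → 𝔸^d` (`p(y) = (E(y) b_k E(y)⁻¹)_k` over a basis `(b_k)` of the commutant of `E(M)`) with
**`E(y γ y⁻¹) = Σ_k ℓ_k(E γ) • p(y)_k`** for every `γ` centralised by `M` and every `y` — so `y ↦ E(y γ y⁻¹)` descends to `G ⧸ M` through a datum INDEPENDENT of `γ`, and smoothly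
in `E γ`. [cite: Rogawski1990, §8.3 pp. 122–124] [cite: Varadarajan1977, I §1.12] -/
theorem exists_adInvariant_datum {G : Type*} [Group G] [TopologicalSpace G] [ContinuousMul G] [ContinuousInv G]
    {𝔸 : Type*} [NormedRing 𝔸] [NormedAlgebra ℝ 𝔸] [FiniteDimensional ℝ 𝔸]
    (E : G → 𝔸) (hEmul : ∀ x y, E (x * y) = E x * E y) (hEone : E 1 = 1) (hE : Continuous E) (M : Subgroup G) :
    ∃ (d : ℕ) (p : G → Fin d → 𝔸) (ℓ : Fin d → (𝔸 →L[ℝ] ℝ)), Continuous p ∧ (∀ y, ∀ m ∈ M, p (y * m) = p y) ∧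
      ∀ γ : G, (∀ m ∈ M, m * γ = γ * m) → ∀ y : G, E (y * γ * y⁻¹) = ∑ k, ℓ k (E γ) • p y k := by
  have hEinv : ∀ x, E x * E x⁻¹ = 1 := fun x => by rw [← hEmul, mul_inv_cancel, hEone]
  -- the commutant of `E(M)` and a linear projection onto it
  let A : Submodule ℝ 𝔸 :=
    { carrier := {m | ∀ s ∈ M, E s * m = m * E s}
      add_mem' := fun {a b} ha hb s hs => by rw [mul_add, add_mul, ha s hs, hb s hs]
      zero_mem' := fun s _ => by rw [mul_zero, zero_mul]
      smul_mem' := fun r m hm s hs => by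
        show E s * (r • m) = r • m * E s
        rw [mul_smul_comm, smul_mul_assoc, hm s hs] }
  have hAmem : ∀ m, m ∈ A ↔ ∀ s ∈ M, E s * m = m * E s := fun _ => Iff.rfl
  obtain ⟨B, hAB⟩ := A.exists_isCompl
  let b := Module.finBasis ℝ A
  let ℓ : Fin (Module.finrank ℝ A) → 𝔸 →ₗ[ℝ] ℝ := fun k => (b.coord k) ∘ₗ (A.projectionOnto B hAB)
  have hrec : ∀ m ∈ A, ∑ k, ℓ k m • ((b k : A) : 𝔸) = m := by
    intro m hm
    have h1 : A.projectionOnto B hAB m = ⟨m, hm⟩ := Submodule.projectionOnto_apply_of_mem_left hAB hm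
    have h2 := congrArg (fun x : A => (x : 𝔸)) (b.sum_repr (⟨m, hm⟩ : A))
    simp only [AddSubmonoidClass.coe_finsetSum, SetLike.val_smul] at h2
    have h3 : ∀ k, ℓ k m = b.repr (⟨m, hm⟩ : A) k := fun k => by
      show b.coord k (A.projectionOnto B hAB m) = _
      rw [h1, Module.Basis.coord_apply]
    simp only [h3]
    exact h2
  -- the datum `p(y) = (E(y) b_k E(y)⁻¹)_k`
  let p : G → Fin (Module.finrank ℝ A) → 𝔸 := fun h k => E h * ((b k : A) : 𝔸) * E h⁻¹
  refine ⟨Module.finrank ℝ A, p, fun k => LinearMap.toContinuousLinearMap (ℓ k),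
    continuous_pi fun k => (hE.mul continuous_const).mul (hE.comp continuous_inv), fun y s hs => ?_, fun γ hγ y => ?_⟩
  · funext k
    have hc : E s * ((b k : A) : 𝔸) = ((b k : A) : 𝔸) * E s := (hAmem _).1 (b k).2 s hs
    show E (y * s) * ((b k : A) : 𝔸) * E (y * s)⁻¹ = E y * ((b k : A) : 𝔸) * E y⁻¹
    rw [_root_.mul_inv_rev, hEmul, hEmul]
    calc E y * E s * ((b k : A) : 𝔸) * (E s⁻¹ * E y⁻¹)
        = E y * (E s * ((b k : A) : 𝔸) * E s⁻¹) * E y⁻¹ := by simp only [mul_assoc]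
      _ = E y * ((b k : A) : 𝔸) * E y⁻¹ := by rw [hc, mul_assoc ((b k : A) : 𝔸), hEinv, mul_one]
  · have hmem : E γ ∈ A := fun s hs => by rw [← hEmul, ← hEmul, hγ s hs]
    have hsum : ∑ k, (LinearMap.toContinuousLinearMap (ℓ k)) (E γ) • p y k = E y * (∑ k, ℓ k (E γ) • ((b k : A) : 𝔸)) * E y⁻¹ := by
      rw [Finset.mul_sum, Finset.sum_mul]
      exact Finset.sum_congr rfl fun k _ => by
        rw [LinearMap.coe_toContinuousLinearMap', mul_smul_comm, smul_mul_assoc]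
    rw [hsum, hrec _ hmem, ← hEmul, ← hEmul]

end AdDatum

section ParamModel

variable (L : Type) [Field L] [NumberField L] [IsCMField L] (α : Fin 3 → L) (S' : Finset {w : InfinitePlace L // IsComplex w})

omit [NumberField L] [IsCMField L] in
/-- **The set of coordinates IN-REGULAR AT THE PLACES `e i`** (no condition at the other places — (B-desc′)'s base point sits ON the `w₀`-wall, `w₀ ∉ range e`) **is open**: it is
the preimage of ★ `InRegG` for the restricted sign pattern under the (continuous) restriction `c ↦ (c (e i))_i`. [cite: Bouaziz1994IntegralesOrbitales, §6.2 p. 591] -/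
theorem isOpen_setOf_inRegAt {ι : Type} [Fintype ι] (e : ι → {w : InfinitePlace L // IsComplex w}) :
    IsOpen {c : {w : InfinitePlace L // IsComplex w} → Fin 3 → ℝ |
      ∀ i (a b : Fin 3), a ≠ b → slotSign L α (e i) a ≠ slotSign L α (e i) b → Circle.exp (c (e i) a) ≠ Circle.exp (c (e i) b)} := by
  have h : {c : {w : InfinitePlace L // IsComplex w} → Fin 3 → ℝ |
      ∀ i (a b : Fin 3), a ≠ b → slotSign L α (e i) a ≠ slotSign L α (e i) b → Circle.exp (c (e i) a) ≠ Circle.exp (c (e i) b)} =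
      (fun c : {w : InfinitePlace L // IsComplex w} → Fin 3 → ℝ => fun i : ι => c (e i)) ⁻¹' InRegG (fun i : ι => slotSign L α (e i)) (∅ : Finset ι) := by
    ext c
    simp only [InRegG, Set.mem_setOf_eq, Set.mem_preimage, Finset.notMem_empty, not_false_eq_true, forall_const]
  rw [h]
  exact (isOpen_inRegG _ _).preimage (continuous_pi fun i => continuous_apply (e i))

/-- **(HYP) ON THE LARGER SET `InRegAt e`** (in-regular at the places `e i` only; ★ (A4) §2 is its restriction to `InRegG (slotSign α) S′`): the compact-place product chart
`c ↦ (gprimeBlock α (e i) S′ c)_i` is uniformly proper modulo `Π_i T′_{S′,e i}` on compacts of `{c | ∀ i a b, a ≠ b → s (e i) a ≠ s (e i) b → e^{ic_{e i,a}} ≠ e^{ic_{e i,b}}}` —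
same proof as ★ (A4) §2 (★ `uniformlyProper_gprimeBlock_of_inRegG_place` per place ∘ ★ `uniformlyProper_pi`; the chart at `e i` only reads `c (e i)`).
[cite: Rogawski1990, §4.12 Lemma 4.12.1 p. 61; §4.3 p. 43] [cite: HarishChandra1970, Part V §4 Lemma 22] [cite: Bouaziz1994IntegralesOrbitales, §6.2 p. 591] -/
theorem uniformlyProper_gprimeBlock_pi_inRegAt (hα : ∀ i, α i ≠ 0) (hreal : ∀ (w : {w : InfinitePlace L // IsComplex w}) (i : Fin 3), (w.1.embedding (α i)).im = 0)
    (hS' : ∀ w, w ∈ S' → w ∈ splitChartPlaces L α) {ι : Type} [Fintype ι] (e : ι → {w : InfinitePlace L // IsComplex w}) (he : ∀ i, e i ∉ S') :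
    ∀ K ⊆ {c : {w : InfinitePlace L // IsComplex w} → Fin 3 → ℝ |
        ∀ i (a b : Fin 3), a ≠ b → slotSign L α (e i) a ≠ slotSign L α (e i) b → Circle.exp (c (e i) a) ≠ Circle.exp (c (e i) b)}, IsCompact K →
      ∀ C : Set (∀ i : ι, ↥(archLocal L 3 (Matrix.diagonal α) (e i))), IsCompact C →
        ∃ 𝒦 : Set ((∀ i : ι, ↥(archLocal L 3 (Matrix.diagonal α) (e i))) ⧸ Subgroup.pi Set.univ (fun i : ι => chartTorusGLoc L α (e i) S')),
          IsCompact 𝒦 ∧ ∀ c ∈ K, ∀ y : (∀ i : ι, ↥(archLocal L 3 (Matrix.diagonal α) (e i))),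
            y * (fun i => gprimeBlock L α (e i) S' c) * y⁻¹ ∈ C →
              (QuotientGroup.mk y : (∀ i : ι, ↥(archLocal L 3 (Matrix.diagonal α) (e i))) ⧸ Subgroup.pi Set.univ (fun i : ι => chartTorusGLoc L α (e i) S')) ∈ 𝒦 := by
  obtain ⟨c₁, hc₁⟩ := (dense_regG S').nonempty
  haveI : ∀ i : ι, LocallyCompactSpace ↥(archLocal L 3 (Matrix.diagonal α) (e i)) := fun i => locallyCompactSpace_archLocal L 3 (Matrix.diagonal α) (e i)
  have hplace : ∀ i : ι,
      ∀ K₁ ⊆ {cw : Fin 3 → ℝ | (e i ∈ S' → cw 0 ≠ 0) ∧ (e i ∉ S' → ∀ a b : Fin 3, a ≠ b → slotSign L α (e i) a ≠ slotSign L α (e i) b → Circle.exp (cw a) ≠ Circle.exp (cw b))},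
        IsCompact K₁ → ∀ C₁ : Set ↥(archLocal L 3 (Matrix.diagonal α) (e i)), IsCompact C₁ →
          ∃ 𝒦₁ : Set (↥(archLocal L 3 (Matrix.diagonal α) (e i)) ⧸ chartTorusGLoc L α (e i) S'), IsCompact 𝒦₁ ∧
            ∀ cw ∈ K₁, ∀ y : ↥(archLocal L 3 (Matrix.diagonal α) (e i)), y * gprimeBlockAt L α (e i) S' cw * y⁻¹ ∈ C₁ →
              (QuotientGroup.mk y : ↥(archLocal L 3 (Matrix.diagonal α) (e i)) ⧸ chartTorusGLoc L α (e i) S') ∈ 𝒦₁ := by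
    intro i
    have hle : chartTorusGLoc L α (e i) S' ≤ Subgroup.centralizer ({gprimeBlock L α (e i) S' c₁} : Set ↥(archLocal L 3 (Matrix.diagonal α) (e i))) :=
      chartTorusGLoc_le_centralizer L α (e i) S' (c₁ (e i))
    have heq := chartTorusGLoc_eq_centralizer_gprimeBlock L α S' hα hS' hc₁ (e i)
    haveI : CompactSpace (↥(Subgroup.centralizer ({gprimeBlock L α (e i) S' c₁} : Set ↥(archLocal L 3 (Matrix.diagonal α) (e i)))) ⧸
        (chartTorusGLoc L α (e i) S').subgroupOf (Subgroup.centralizer ({gprimeBlock L α (e i) S' c₁} : Set ↥(archLocal L 3 (Matrix.diagonal α) (e i))))) := by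
      have htop : (chartTorusGLoc L α (e i) S').subgroupOf (Subgroup.centralizer ({gprimeBlock L α (e i) S' c₁} : Set ↥(archLocal L 3 (Matrix.diagonal α) (e i)))) = ⊤ := by
        rw [heq, Subgroup.subgroupOf_self]
      rw [htop]
      infer_instance
    exact uniformlyProper_of_le_of_compactSpace_quotient _ _ hle _ _ (uniformlyProper_gprimeBlock_of_inRegG_place L α S' hα hreal hS' hc₁ (e i))
  have hpi := uniformlyProper_pi (fun i : ι => chartTorusGLoc L α (e i) S') (fun i cw => gprimeBlockAt L α (e i) S' cw) _ hplace
  intro K hK hKc C hC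
  have hK' : (fun c : {w : InfinitePlace L // IsComplex w} → Fin 3 → ℝ => fun i : ι => c (e i)) '' K ⊆
      Set.pi Set.univ fun i : ι =>
        {cw : Fin 3 → ℝ | (e i ∈ S' → cw 0 ≠ 0) ∧ (e i ∉ S' → ∀ a b : Fin 3, a ≠ b → slotSign L α (e i) a ≠ slotSign L α (e i) b → Circle.exp (cw a) ≠ Circle.exp (cw b))} := by
    rintro _ ⟨c, hc, rfl⟩ i -
    exact ⟨fun h => absurd h (he i), fun _ a b hab hs => hK hc i a b hab hs⟩
  obtain ⟨𝒦, h𝒦, hmem⟩ := hpi _ hK' (hKc.image (continuous_pi fun i => continuous_apply (e i))) C hC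
  exact ⟨𝒦, h𝒦, fun c hc y hy => hmem _ ⟨c, hc, rfl⟩ y hy⟩

/-- **(A4′) HEAD — THE PARAMETRIC, ABSTRACT-INTEGRAND SMOOTH MODEL IS `C^∞` ON `InRegAt e × T`.**  Same compact-place data as the (A4) head (`hα hreal hS′`, a family `e : ι → W` of
compact-chart places with `e i ∉ S′`, a measure `μ` finite on compacta on `(Π_i U(α)_{e i}) ⧸ (Π_i T′_{S′,e i})`), but now: an extra finite-dimensional parameter `z ∈ T ⊆ Z` (`T` open —
(B-desc′): the `w₀`-block variable), an ABSTRACT fibre `Y` (T₂, second countable) with an s-finite measure `ν` finite on compacta and a continuous datum `r : Y → Q`, and an ABSTRACT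
fibred integrand `F : (V × Z) → G_c → Y → ℂ` that (i) FACTORS SMOOTHLY through the matrix reading of the compact places, `F q g η = Θ (((↑↑g_i)_i, r η), q)` with `Θ` jointly `C^∞`
(absorbs `a′ ∘ ρ_z`, the ambient reading `Λ`, the split-place movers, any cut-off — the parameter may enter anywhere smoothly), and (ii) is SUPPORTED, for `q` in any compact
`K ⊆ InRegAt e × T`, in ONE compact of `G_c` times ONE compact of `Y`; a prefactor `pref` smooth on `InRegAt e × T`.  Conclusion:
**`q ↦ pref q · ∫_{(G_c ⧸ M_c) × Y} F q (y · γ_c(q.1) · y⁻¹) η d(μ ⊗ ν)` is `ContDiffOn ℝ ∞` on `{c | in-regular at every e i} ×ˢ T`** — localised (A4-gen)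
`contDiffOn_integral_prod_descConj_fibre_of_uniformlyProper_local` on relatively compact `S′ × T′ ∋ (c₀, z₀)` (§2 (HYP), ★ (A4) §3 `hcomm`, §1 `exists_adInvariant_datum` for the `M_c`-invariant
datum: `F q (y γ_c y⁻¹) η = Θ ((Σ_k ℓ_k(↑↑γ_c(q.1)) • p(y)_k, r η), q)`).  The (A4) head `contDiffOn_smoothModel_inRegG` is the case `F = a′ ∘ ρ`, `Y = Π_j (K_j × N)`, no parameter.
[cite: Varadarajan1977, I §1.12] [cite: Rogawski1990, §8.2–§8.3 pp. 118–124; §4.12 Lemma 4.12.1 p. 61] [cite: Bouaziz1994IntegralesOrbitales, §6.2 p. 591]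
[cite: HormanderALPDO1, §1.1 Thm. 1.1.9] -/
theorem contDiffOn_smoothModel_prod_param (hα : ∀ i, α i ≠ 0) (hreal : ∀ (w : {w : InfinitePlace L // IsComplex w}) (i : Fin 3), (w.1.embedding (α i)).im = 0)
    (hS' : ∀ w, w ∈ S' → w ∈ splitChartPlaces L α)
    {ι : Type} [Fintype ι] (e : ι → {w : InfinitePlace L // IsComplex w}) (he : ∀ i, e i ∉ S')
    [MeasurableSpace ((∀ i : ι, ↥(archLocal L 3 (Matrix.diagonal α) (e i))) ⧸ Subgroup.pi Set.univ (fun i : ι => chartTorusGLoc L α (e i) S'))]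
    [BorelSpace ((∀ i : ι, ↥(archLocal L 3 (Matrix.diagonal α) (e i))) ⧸ Subgroup.pi Set.univ (fun i : ι => chartTorusGLoc L α (e i) S'))]
    (μ : Measure ((∀ i : ι, ↥(archLocal L 3 (Matrix.diagonal α) (e i))) ⧸ Subgroup.pi Set.univ (fun i : ι => chartTorusGLoc L α (e i) S')))
    [IsFiniteMeasureOnCompacts μ]
    {Y : Type*} [TopologicalSpace Y] [T2Space Y] [SecondCountableTopology Y] [MeasurableSpace Y] [OpensMeasurableSpace Y]
    (ν : Measure Y) [IsFiniteMeasureOnCompacts ν] [SFinite ν]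
    {Z : Type*} [NormedAddCommGroup Z] [NormedSpace ℝ Z] [FiniteDimensional ℝ Z] {T : Set Z} (hT : IsOpen T)
    {Q : Type*} [NormedAddCommGroup Q] [NormedSpace ℝ Q] (r : Y → Q) (hr : Continuous r)
    (F : ({w : InfinitePlace L // IsComplex w} → Fin 3 → ℝ) × Z → (∀ i : ι, ↥(archLocal L 3 (Matrix.diagonal α) (e i))) → Y → ℂ)
    (Θ : ((ι → Matrix (Fin 3) (Fin 3) ℂ) × Q) × (({w : InfinitePlace L // IsComplex w} → Fin 3 → ℝ) × Z) → ℂ) (hΘ : ContDiff ℝ ∞ Θ)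
    (hFΘ : ∀ q g η, F q g η = Θ (((fun i => (((g i : ↥(archLocal L 3 (Matrix.diagonal α) (e i))) : GL (Fin 3) ℂ) : Matrix (Fin 3) (Fin 3) ℂ)), r η), q))
    (hFsupp : ∀ K ⊆ {c : {w : InfinitePlace L // IsComplex w} → Fin 3 → ℝ |
          ∀ i (a b : Fin 3), a ≠ b → slotSign L α (e i) a ≠ slotSign L α (e i) b → Circle.exp (c (e i) a) ≠ Circle.exp (c (e i) b)} ×ˢ T,
        IsCompact K → ∃ A : Set (∀ i : ι, ↥(archLocal L 3 (Matrix.diagonal α) (e i))), ∃ Y₀ : Set Y, IsCompact A ∧ IsCompact Y₀ ∧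
          ∀ q ∈ K, ∀ g η, F q g η ≠ 0 → g ∈ A ∧ η ∈ Y₀)
    (pref : ({w : InfinitePlace L // IsComplex w} → Fin 3 → ℝ) × Z → ℂ)
    (hpref : ContDiffOn ℝ ∞ pref ({c : {w : InfinitePlace L // IsComplex w} → Fin 3 → ℝ |
        ∀ i (a b : Fin 3), a ≠ b → slotSign L α (e i) a ≠ slotSign L α (e i) b → Circle.exp (c (e i) a) ≠ Circle.exp (c (e i) b)} ×ˢ T)) :
    ContDiffOn ℝ ∞ (fun q : ({w : InfinitePlace L // IsComplex w} → Fin 3 → ℝ) × Z => pref q *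
        ∫ w : ((∀ i : ι, ↥(archLocal L 3 (Matrix.diagonal α) (e i))) ⧸ Subgroup.pi Set.univ (fun i : ι => chartTorusGLoc L α (e i) S')) × Y,
          descConj (fun i : ι => gprimeBlock L α (e i) S' q.1) (Subgroup.pi Set.univ (fun i : ι => chartTorusGLoc L α (e i) S'))
            (forall_mem_pi_chartTorusGLoc_comm L α S' e q.1) (fun g => F q g w.2) w.1 ∂(μ.prod ν))
      ({c : {w : InfinitePlace L // IsComplex w} → Fin 3 → ℝ |
        ∀ i (a b : Fin 3), a ≠ b → slotSign L α (e i) a ≠ slotSign L α (e i) b → Circle.exp (c (e i) a) ≠ Circle.exp (c (e i) b)} ×ˢ T) := by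
  haveI : ∀ i : ι, LocallyCompactSpace ↥(archLocal L 3 (Matrix.diagonal α) (e i)) := fun i => locallyCompactSpace_archLocal L 3 (Matrix.diagonal α) (e i)
  haveI : IsClosed ((Subgroup.pi Set.univ (fun i : ι => chartTorusGLoc L α (e i) S')) : Set (∀ i : ι, ↥(archLocal L 3 (Matrix.diagonal α) (e i)))) := by
    rw [Subgroup.coe_pi]
    exact isClosed_set_pi fun i _ => isClosed_chartTorusGLoc L α (e i) S'
  -- the compact-place matrix reading and its `M_c`-invariant datum
  let Ebar : (∀ i : ι, ↥(archLocal L 3 (Matrix.diagonal α) (e i))) → (ι → Matrix (Fin 3) (Fin 3) ℂ) :=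
    fun y i => (((y i : ↥(archLocal L 3 (Matrix.diagonal α) (e i))) : GL (Fin 3) ℂ) : Matrix (Fin 3) (Fin 3) ℂ)
  have hEmul : ∀ x y, Ebar (x * y) = Ebar x * Ebar y := fun x y => by
    funext i
    simp only [Ebar, Pi.mul_apply, Subgroup.coe_mul, Units.val_mul]
  have hEone : Ebar 1 = 1 := by
    funext i
    simp only [Ebar, Pi.one_apply, OneMemClass.coe_one, Units.val_one]
  have hEcont : Continuous Ebar :=
    continuous_pi fun i => (Units.continuous_val.comp continuous_subtype_val).comp (continuous_apply i)
  have hEγ : ContDiff ℝ ∞ fun c : {w : InfinitePlace L // IsComplex w} → Fin 3 → ℝ => Ebar (fun i : ι => gprimeBlock L α (e i) S' c) :=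
    contDiff_pi.2 fun i => contDiff_coe_gprimeBlock L α S' (e i)
  obtain ⟨d, p, ℓ, hp, hpM, had⟩ := exists_adInvariant_datum Ebar hEmul hEone hEcont (Subgroup.pi Set.univ (fun i : ι => chartTorusGLoc L α (e i) S'))
  -- the smooth factorisation `Ψ ((m, s), q) = Θ ((Σ_k ℓ_k(Ebar γ_c(q.1)) • m_k, s), q)`
  obtain ⟨Ψ, hΨdef⟩ : ∃ Ψ : ((Fin d → (ι → Matrix (Fin 3) (Fin 3) ℂ)) × Q) × (({w : InfinitePlace L // IsComplex w} → Fin 3 → ℝ) × Z) → ℂ,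
      Ψ = fun s => Θ ((∑ k, ℓ k (Ebar fun i : ι => gprimeBlock L α (e i) S' s.2.1) • s.1.1 k, s.1.2), s.2) := ⟨_, rfl⟩
  have hΨ : ContDiff ℝ ∞ Ψ := by
    rw [hΨdef]
    refine hΘ.comp ((ContDiff.prodMk ?_ (contDiff_snd.comp contDiff_fst)).prodMk contDiff_snd)
    refine ContDiff.sum fun k _ => ?_
    exact ((ℓ k).contDiff.comp (hEγ.comp (contDiff_fst.comp contDiff_snd))).smul
      ((contDiff_apply ℝ (ι → Matrix (Fin 3) (Fin 3) ℂ) k).comp (contDiff_fst.comp contDiff_fst))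
  have hfac : ∀ (q : ({w : InfinitePlace L // IsComplex w} → Fin 3 → ℝ) × Z) (y : ∀ i : ι, ↥(archLocal L 3 (Matrix.diagonal α) (e i))) (η : Y),
      F q (y * (fun i : ι => gprimeBlock L α (e i) S' q.1) * y⁻¹) η = Ψ ((p y, r η), q) := by
    intro q y η
    rw [hFΘ, hΨdef]
    simp only
    rw [← had _ (forall_mem_pi_chartTorusGLoc_comm L α S' e q.1) y]
  -- localise: smoothness near `(c₀, z₀)` from (A4-gen) on a relatively compact open box `S₁ × T₁`
  rintro ⟨c₀, z₀⟩ hq₀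
  rw [Set.mem_prod] at hq₀
  obtain ⟨KS, hKSnhds, hKSsub, hKS⟩ := local_compact_nhds ((isOpen_setOf_inRegAt L α e).mem_nhds hq₀.1)
  obtain ⟨KT, hKTnhds, hKTsub, hKT⟩ := local_compact_nhds (hT.mem_nhds hq₀.2)
  obtain ⟨A, Y₀, hA, hY₀, hsupp⟩ := hFsupp (KS ×ˢ KT) (Set.prod_mono hKSsub hKTsub) (hKS.prod hKT)
  have hS₁ : IsOpen (interior KS) := isOpen_interior
  have hT₁ : IsOpen (interior KT) := isOpen_interior
  have hprop := uniformlyProper_gprimeBlock_pi_inRegAt L α S' hα hreal hS' e he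
  have key := contDiffOn_integral_prod_descConj_fibre_of_uniformlyProper_local
    (Subgroup.pi Set.univ (fun i : ι => chartTorusGLoc L α (e i) S'))
    (c := fun (c : {w : InfinitePlace L // IsComplex w} → Fin 3 → ℝ) (i : ι) => gprimeBlock L α (e i) S' c)
    (forall_mem_pi_chartTorusGLoc_comm L α S' e) hS₁
    (fun K hK hKc C hC => hprop K (fun c hc => hKSsub (interior_subset (hK hc))) hKc C hC) μ ν hT₁ (Φ := F) hA
    (fun q hq g hg η => by
      by_contra hne
      exact hg (hsupp q (Set.prod_mono interior_subset interior_subset hq) g η hne).1)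
    (fun K hK _ => ⟨Y₀, hY₀, fun q hq g η hη => by
      by_contra hne
      exact hη (hsupp q (Set.prod_mono interior_subset interior_subset (hK hq)) g η hne).2⟩)
    p hp hpM r hr Ψ hΨ hfac
  have hnhds : interior KS ×ˢ interior KT ∈ 𝓝 (c₀, z₀) :=
    prod_mem_nhds (isOpen_interior.mem_nhds (mem_interior_iff_mem_nhds.2 hKSnhds)) (isOpen_interior.mem_nhds (mem_interior_iff_mem_nhds.2 hKTnhds))
  have hpref' : ContDiffAt ℝ ∞ pref (c₀, z₀) :=
    (hpref (c₀, z₀) (Set.mk_mem_prod hq₀.1 hq₀.2)).contDiffAt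
      (Filter.mem_of_superset hnhds (Set.prod_mono (interior_subset.trans hKSsub) (interior_subset.trans hKTsub)))
  exact (hpref'.mul ((key (c₀, z₀) (Set.mk_mem_prod (mem_interior_iff_mem_nhds.2 hKSnhds) (mem_interior_iff_mem_nhds.2 hKTnhds))).contDiffAt
    ((hS₁.prod hT₁).mem_nhds (Set.mk_mem_prod (mem_interior_iff_mem_nhds.2 hKSnhds) (mem_interior_iff_mem_nhds.2 hKTnhds))))).contDiffWithinAt

end ParamModel

end Literature.NumberTheory.Automorphic.UnitaryGroup

end
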